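import Summits.Ventures.Crystal3D.Theorems.StickyWulffConstantNoReconstructionGainWindowBarlowLocal
import HarnessLib

/-!
# Single-family Barlow films BEYOND the `54.7°` cone, II: the window where the plain `ν`-height certifies

HONEST FRAMING. Part of the venture `Summits/Ventures/Crystal3D` (cell `crystal3d-full`), helper
`--supports` the crux `NoReconstructionGain` (stmt-Ventures-19144, route
`route-Ventures-StickyWulffConstant`), line `adhesion`; continuation of `…BasalBarlowFilm`
(`basalBarlowFilm_adhesion`: every film inside `B = Λ₀ ∪ (Λ₀ + w) ∪ (Λ₀ − w)` — ALL Barlow positions of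
the basal family — at normals with `ν₃² > 1/3`, potential = the `ν`-height) and `…WindowBarlowLocal`.

Put `α = √(2/3)|ν₃|` and `β_τ = ⟪τ, ν⟫` for `τ` in the hollow triple `{w, w − u, w − v}` (`Σ β_τ = 0`).
The basal theorem is the regime `max |β_τ| < α`.  The **window** is the regime in which exactly ONE
`|β_τ|` is `< α` and the other two are `> α` (then one is `> α`, one `< −α`):

* `window_noGainPotential` — the per-ball lemma (orientation `N' = ±N` by the sign of `ν₃`, either
  order of the two large values; partners classified by `basal_unit_vectors`);
* `windowBarlowFilm_adhesion` (**the rung**, `R = 1`, `C = 0`; registered by name on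
  stmt-Ventures-19144): for every unit `ν` in the window, every `ρ ≥ 1`, every finite unit packing
  `X ⊇ P` around the `ν`-slab sample whose film lies in `B` and above the cut:
  `#cross(P, X \ P) ≤ contactDeficiency (X \ P)`.  Twin lamellae, hcp/dhcp grains, faults reaching
  the interface, islands of both hollow types, domain mixtures — every coordination, no rim set.

Numbers (lead folder calc/bfilm_window_check.py: exhaustive over the 25 maximal admissible partner sets
of a `B`-ball × 40 000 random normals): the plain `ν`-height certifies every `B`-film EXACTLY on
basal ∪ window = 43.9 % + 26.6 % = 70.5 % of all normals (per family; zero mismatches); on the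
complement some admissible twelve-partner set costs `14`, and since the per-ball cost depends only on
the sign cell of the grading among the eighteen contact vectors while every other cell mis-orients a
possible substrate contact, NO linear potential is universal there (film-dependent certificates or
flows are needed, RUNGS-g8 §2.6).  The window contains, e.g., all normals beyond the cone at the
azimuths of the in-plane bond directions, up to `θ = 90°`.

WHAT THIS IS NOT: the residual `29.5 %` of normals for single-family films (around the azimuths of the
hollow vectors, containing the vicinal non-basal `{111}` normals); films mixing Barlow families; the
other three families (lattice-symmetry transport, next file); rung F-C1 not moved.
-/

noncomputable section

namespace Summit.Ventures.Crystal3D.Theorems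

open Summit.Ventures.Crystal3D Finset
open Literature.MathematicalPhysics.StatisticalMechanics (barlowPos barlowStacking fccStacking
  barlowOffset triangularVec₁ triangularVec₂ layerNormal constHagg haggLabel_const barlowPos_apply_zero
  barlowPos_apply_one barlowPos_apply_two three_smul_barlowOffset orderedContacts contactDeficiency)
open scoped InnerProductSpace

/-! ### The per-ball lemma for `B`-films -/

/-- **(T2) at a ball of a `B`-film in the window regime** (`N' = ±N` according to the sign of `ν₃`;
partners classified by `basal_unit_vectors`).  The two large hollow values may come in either order. -/
theorem window_noGainPotential (X P : Finset (EuclideanSpace ℝ (Fin 3)))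
    (hX : ∀ p ∈ X, ∀ q ∈ X, p ≠ q → 1 ≤ dist p q) (hPX : P ⊆ X)
    (q : EuclideanSpace ℝ (Fin 3)) (Φ : EuclideanSpace ℝ (Fin 3) → ℤ)
    (ν N' τ₀ τ₁ τ₂ : EuclideanSpace ℝ (Fin 3))
    (hN' : N' = layerNormal (Real.sqrt (2 / 3)) ∨ N' = -layerNormal (Real.sqrt (2 / 3)))
    (hT : ∀ τ ∈ ([barlowOffset 1, barlowOffset 1 - barlowPos 1 (Real.sqrt (2 / 3)) constHagg 0 1 0,
        barlowOffset 1 - barlowPos 1 (Real.sqrt (2 / 3)) constHagg 0 0 1] : List (EuclideanSpace ℝ (Fin 3))),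
        τ = τ₀ ∨ τ = τ₁ ∨ τ = τ₂)
    (hn₀ : ‖τ₀‖ ^ 2 = 1 / 3) (hn₁ : ‖τ₁‖ ^ 2 = 1 / 3) (hn₂ : ‖τ₂‖ ^ 2 = 1 / 3)
    (hsum : τ₀ + τ₁ + τ₂ = 0)
    (h₀ : |⟪τ₀, ν⟫_ℝ| < ⟪N', ν⟫_ℝ) (h₁ : ⟪N', ν⟫_ℝ < |⟪τ₁, ν⟫_ℝ|) (h₂ : ⟪N', ν⟫_ℝ < |⟪τ₂, ν⟫_ℝ|)
    (hlt : ∀ x ∈ X \ P, dist q x = 1 → (Φ x < Φ q ↔ ⟪x, ν⟫_ℝ < ⟪q, ν⟫_ℝ))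
    (heq : ∀ x ∈ X \ P, dist q x = 1 → (Φ x = Φ q ↔ ⟪x, ν⟫_ℝ = ⟪q, ν⟫_ℝ))
    (hplug : ∀ p ∈ P, dist q p = 1 → ⟪p, ν⟫_ℝ < ⟪q, ν⟫_ℝ)
    (hdir : ∀ x ∈ X, dist q x = 1 →
      (∃ c ∈ ([((0 : ℤ), (1 : ℤ), (0 : ℤ)), (0, 0, 1), (1, 0, 0), (0, 1, -1), (-1, 1, 0), (-1, 0, 1)] :
          List (ℤ × ℤ × ℤ)),
          x - q = barlowPos 1 (Real.sqrt (2 / 3)) constHagg c.1 c.2.1 c.2.2 ∨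
          x - q = -barlowPos 1 (Real.sqrt (2 / 3)) constHagg c.1 c.2.1 c.2.2) ∨
        (∃ c ∈ ([((1 : ℤ), (-1 : ℤ), (-1 : ℤ)), (1, 0, -1), (1, -1, 0)] : List (ℤ × ℤ × ℤ)),
          x - q = barlowPos 1 (Real.sqrt (2 / 3)) constHagg c.1 c.2.1 c.2.2 + barlowOffset 1 ∨
          x - q = -(barlowPos 1 (Real.sqrt (2 / 3)) constHagg c.1 c.2.1 c.2.2 + barlowOffset 1))) :
    (((X \ P).filter fun x => dist q x = 1 ∧ Φ x < Φ q).card : ℤ)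
        + ((P.filter fun p => dist q p = 1).card : ℤ)
      ≤ (12 - ((X.filter fun x => dist q x = 1).card : ℤ))
        + (((X \ P).filter fun x => dist q x = 1 ∧ Φ q < Φ x).card : ℤ) := by
  classical
  set E3 : List (EuclideanSpace ℝ (Fin 3)) := [barlowPos 1 (Real.sqrt (2 / 3)) constHagg 0 1 0,
    barlowPos 1 (Real.sqrt (2 / 3)) constHagg 0 0 1, barlowPos 1 (Real.sqrt (2 / 3)) constHagg 0 1 (-1)]
    with hE3
  -- partners in the abstract form
  have hdir' : ∀ x ∈ X, dist q x = 1 →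
      (∃ e ∈ E3, x - q = e ∨ x - q = -e) ∨
      (∃ τ ∈ [τ₀, τ₁, τ₂], x - q = N' + τ ∨ x - q = N' - τ ∨ x - q = -(N' + τ) ∨ x - q = -(N' - τ)) := by
    intro x hx hd
    rcases basal_polar_or_inplane (hdir x hx hd) with ⟨c, hc, hcx⟩ | ⟨τ, hτ, hτx⟩
    · left
      simp only [List.mem_cons, List.mem_nil_iff, or_false] at hc
      rcases hc with rfl | rfl | rfl
      · exact ⟨_, by simp [hE3], hcx⟩
      · exact ⟨_, by simp [hE3], hcx⟩
      · exact ⟨_, by simp [hE3], hcx⟩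
    · right
      have hτ' : τ ∈ [τ₀, τ₁, τ₂] := by
        rcases hT τ hτ with rfl | rfl | rfl <;> simp
      refine ⟨τ, hτ', ?_⟩
      rcases hN' with rfl | rfl
      · exact hτx
      · rcases hτx with h | h | h | h
        · exact Or.inr (Or.inr (Or.inr (by rw [h]; abel)))
        · exact Or.inr (Or.inr (Or.inl (by rw [h]; abel)))
        · exact Or.inr (Or.inl (by rw [h]; abel))
        · exact Or.inl (by rw [h]; abel)
  -- the signs of the two large hollow values
  have hN0 : 0 < ⟪N', ν⟫_ℝ := lt_of_le_of_lt (abs_nonneg _) h₀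
  have hβsum : ⟪τ₀, ν⟫_ℝ + ⟪τ₁, ν⟫_ℝ + ⟪τ₂, ν⟫_ℝ = 0 := by
    rw [← inner_add_left, ← inner_add_left, hsum, inner_zero_left]
  have h0l : -⟪N', ν⟫_ℝ < ⟪τ₀, ν⟫_ℝ := by have := neg_abs_le ⟪τ₀, ν⟫_ℝ; linarith
  have h0r : ⟪τ₀, ν⟫_ℝ < ⟪N', ν⟫_ℝ := lt_of_le_of_lt (le_abs_self _) h₀
  by_cases hs : 0 ≤ ⟪τ₁, ν⟫_ℝ
  · -- `τ₁` positive, `τ₂` negative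
    have h1' : ⟪N', ν⟫_ℝ < ⟪τ₁, ν⟫_ℝ := by rwa [abs_of_nonneg hs] at h₁
    have h2' : ⟪τ₂, ν⟫_ℝ < -⟪N', ν⟫_ℝ := by
      rcases le_or_gt 0 ⟪τ₂, ν⟫_ℝ with h | h
      · rw [abs_of_nonneg h] at h₂; linarith
      · rw [abs_of_neg h] at h₂; linarith
    exact window_noGainPotential_core X P hX hPX q Φ ν N' τ₀ τ₁ τ₂ E3 (by simp [hE3]) hn₀ hn₁ hn₂ hsum
      h₀ h1' h2' hlt heq hplug hdir'
  · -- `τ₂` positive, `τ₁` negative: swap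
    push Not at hs
    have h1' : ⟪τ₁, ν⟫_ℝ < -⟪N', ν⟫_ℝ := by rw [abs_of_neg hs] at h₁; linarith
    have h2' : ⟪N', ν⟫_ℝ < ⟪τ₂, ν⟫_ℝ := by
      rcases le_or_gt 0 ⟪τ₂, ν⟫_ℝ with h | h
      · rwa [abs_of_nonneg h] at h₂
      · rw [abs_of_neg h] at h₂; linarith
    refine window_noGainPotential_core X P hX hPX q Φ ν N' τ₀ τ₂ τ₁ E3 (by simp [hE3]) hn₀ hn₂ hn₁
      (by rw [← hsum]; abel) h₀ h2' h1' hlt heq hplug fun x hx hd => ?_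
    rcases hdir' x hx hd with h | ⟨τ, hτ, hτx⟩
    · exact Or.inl h
    · right
      refine ⟨τ, ?_, hτx⟩
      simp only [List.mem_cons, List.mem_nil_iff, or_false] at hτ ⊢
      tauto

/-! ### The rung -/

/-- **The atom for basal-family Barlow films in the window beyond the `54.7°` cone** (`R = 1`,
`C = 0`; registered by name on stmt-Ventures-19144).  For every unit `ν` such that, with
`s = √(2/3)|ν₃|`, exactly one of `|⟪w,ν⟫|, |⟪w−u,ν⟫|, |⟪w−v,ν⟫|` is `< s` and the other two are `> s`
(`w = barlowOffset 1`, `u, v` the sites `(0,1,0), (0,0,1)` of `Λ₀ = fccStacking 1 √(2/3)`), every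
`ρ ≥ 1`, and every finite unit packing `X ⊇ P` around the `ν`-slab sample `P` whose film balls lie in
`Λ₀ ∪ (Λ₀ + w) ∪ (Λ₀ − w)` and above the cut (`−R < ⟪q, ν⟫`): `#cross(P, X \ P) ≤ contactDeficiency (X \ P)`. -/
theorem windowBarlowFilm_adhesion :
    ∃ R C : ℝ, 1 ≤ R ∧ ∀ ν : EuclideanSpace ℝ (Fin 3), ‖ν‖ = 1 → ∀ ρ : ℝ, R ≤ ρ →
      ∀ X P : Finset (EuclideanSpace ℝ (Fin 3)),
      (∀ p ∈ X, ∀ q ∈ X, p ≠ q → 1 ≤ dist p q) → P ⊆ X →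
      (∀ p, p ∈ P ↔ (p ∈ fccStacking 1 (Real.sqrt (2 / 3)) ∧ -(2 * R) ≤ ⟪p, ν⟫_ℝ ∧
        ⟪p, ν⟫_ℝ ≤ -R ∧ ‖p‖ ^ 2 - ⟪p, ν⟫_ℝ ^ 2 ≤ ρ ^ 2)) →
      ((|⟪barlowOffset 1, ν⟫_ℝ| < Real.sqrt (2 / 3) * |ν 2| ∧
          Real.sqrt (2 / 3) * |ν 2| < |⟪barlowOffset 1 - barlowPos 1 (Real.sqrt (2 / 3)) constHagg 0 1 0, ν⟫_ℝ| ∧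
          Real.sqrt (2 / 3) * |ν 2| < |⟪barlowOffset 1 - barlowPos 1 (Real.sqrt (2 / 3)) constHagg 0 0 1, ν⟫_ℝ|) ∨
        (|⟪barlowOffset 1 - barlowPos 1 (Real.sqrt (2 / 3)) constHagg 0 1 0, ν⟫_ℝ| < Real.sqrt (2 / 3) * |ν 2| ∧
          Real.sqrt (2 / 3) * |ν 2| < |⟪barlowOffset 1, ν⟫_ℝ| ∧
          Real.sqrt (2 / 3) * |ν 2| < |⟪barlowOffset 1 - barlowPos 1 (Real.sqrt (2 / 3)) constHagg 0 0 1, ν⟫_ℝ|) ∨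
        (|⟪barlowOffset 1 - barlowPos 1 (Real.sqrt (2 / 3)) constHagg 0 0 1, ν⟫_ℝ| < Real.sqrt (2 / 3) * |ν 2| ∧
          Real.sqrt (2 / 3) * |ν 2| < |⟪barlowOffset 1, ν⟫_ℝ| ∧
          Real.sqrt (2 / 3) * |ν 2| < |⟪barlowOffset 1 - barlowPos 1 (Real.sqrt (2 / 3)) constHagg 0 1 0, ν⟫_ℝ|)) →
      (∀ q ∈ X \ P, q ∈ fccStacking 1 (Real.sqrt (2 / 3)) ∨
        q - barlowOffset 1 ∈ fccStacking 1 (Real.sqrt (2 / 3)) ∨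
        q + barlowOffset 1 ∈ fccStacking 1 (Real.sqrt (2 / 3))) →
      (∀ q ∈ X \ P, -R < ⟪q, ν⟫_ℝ) →
      ((((P ×ˢ (X \ P)).filter fun pq => dist pq.1 pq.2 = 1).card : ℕ) : ℝ) ≤
        contactDeficiency (X \ P) + C * ρ := by
  classical
  refine ⟨1, 0, le_rfl, fun ν hν ρ hρ X P hX hPX hP hwin hfilm habove => ?_⟩
  rw [zero_mul, add_zero]
  -- names
  set w : EuclideanSpace ℝ (Fin 3) := barlowOffset 1 with hw
  set wu : EuclideanSpace ℝ (Fin 3) := barlowOffset 1 - barlowPos 1 (Real.sqrt (2 / 3)) constHagg 0 1 0 with hwu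
  set wv : EuclideanSpace ℝ (Fin 3) := barlowOffset 1 - barlowPos 1 (Real.sqrt (2 / 3)) constHagg 0 0 1 with hwv
  have hnw : ‖w‖ ^ 2 = 1 / 3 := norm_sq_barlowOffset'
  have hnwu : ‖wu‖ ^ 2 = 1 / 3 := norm_sq_barlowOffset_sub_u
  have hnwv : ‖wv‖ ^ 2 = 1 / 3 := norm_sq_barlowOffset_sub_v
  have hsum : w + wu + wv = 0 := hollow_triple_sum
  -- the oriented normal `N' = ±N` with `⟪N', ν⟫ = √(2/3)|ν₃| > 0`
  obtain ⟨N', hN', hN'ν⟩ : ∃ N' : EuclideanSpace ℝ (Fin 3),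
      (N' = layerNormal (Real.sqrt (2 / 3)) ∨ N' = -layerNormal (Real.sqrt (2 / 3))) ∧
      ⟪N', ν⟫_ℝ = Real.sqrt (2 / 3) * |ν 2| := by
    rcases le_or_gt 0 (ν 2) with h | h
    · exact ⟨_, Or.inl rfl, by rw [inner_layerNormal_left, abs_of_nonneg h]⟩
    · exact ⟨_, Or.inr rfl, by rw [inner_neg_left, inner_layerNormal_left, abs_of_neg h]; ring⟩
  set f : EuclideanSpace ℝ (Fin 3) → ℝ := fun y => ⟪y, ν⟫_ℝ with hf
  set Φ : EuclideanSpace ℝ (Fin 3) → ℤ := fun x => (((X \ P).filter fun y => f y < f x).card : ℤ) with hΦ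
  have hB : ∀ y ∈ X, y ∈ fccStacking 1 (Real.sqrt (2 / 3)) ∨
      y - barlowOffset 1 ∈ fccStacking 1 (Real.sqrt (2 / 3)) ∨
      y + barlowOffset 1 ∈ fccStacking 1 (Real.sqrt (2 / 3)) := by
    intro y hy
    by_cases hyP : y ∈ P
    · exact Or.inl ((hP y).1 hyP).1
    · exact hfilm y (mem_sdiff.2 ⟨hy, hyP⟩)
  have hmain := cross_le_of_potential X P ∅ hX hPX (empty_subset _) Φ fun q hq => by
    rw [sdiff_empty] at hq
    have hlt : ∀ x ∈ X \ P, dist q x = 1 → (Φ x < Φ q ↔ ⟪x, ν⟫_ℝ < ⟪q, ν⟫_ℝ) := fun x hx _ => by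
      simp only [hΦ]; exact rank_lt_iff (X \ P) f x q hx
    have heq : ∀ x ∈ X \ P, dist q x = 1 → (Φ x = Φ q ↔ ⟪x, ν⟫_ℝ = ⟪q, ν⟫_ℝ) := fun x hx _ => by
      simp only [hΦ]; exact rank_eq_iff (X \ P) f x q hx hq
    have hplug : ∀ p ∈ P, dist q p = 1 → ⟪p, ν⟫_ℝ < ⟪q, ν⟫_ℝ := fun p hp _ => by
      obtain ⟨_, _, hp2, _⟩ := (hP p).1 hp
      have := habove q hq
      linarith
    have hdir := fun x hx hd => basal_unit_vectors (hB q (mem_sdiff.1 hq).1) (hB x hx) hd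
    rw [← hN'ν] at hwin
    rcases hwin with ⟨h0, h1, h2⟩ | ⟨h0, h1, h2⟩ | ⟨h0, h1, h2⟩
    · exact window_noGainPotential X P hX hPX q Φ ν N' w wu wv hN'
        (fun τ hτ => by simp only [List.mem_cons, List.mem_nil_iff, or_false] at hτ; tauto)
        hnw hnwu hnwv hsum h0 h1 h2 hlt heq hplug hdir
    · exact window_noGainPotential X P hX hPX q Φ ν N' wu w wv hN'
        (fun τ hτ => by simp only [List.mem_cons, List.mem_nil_iff, or_false] at hτ; tauto)
        hnwu hnw hnwv (by rw [← hsum]; abel) h0 h1 h2 hlt heq hplug hdir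
    · exact window_noGainPotential X P hX hPX q Φ ν N' wv w wu hN'
        (fun τ hτ => by simp only [List.mem_cons, List.mem_nil_iff, or_false] at hτ; tauto)
        hnwv hnw hnwu (by rw [← hsum]; abel) h0 h1 h2 hlt heq hplug hdir
  simpa using hmain

end Summit.Ventures.Crystal3D.Theorems

end
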